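import Literature.Barriers.FinalStateConjecture.TrappingDerivativeLossBeams
import Literature.Geometry.Lorentzian.KerrSchildEnergyEstimate
import Literature.Geometry.Lorentzian.KerrSurgeryBackgroundBounds
import Literature.Geometry.Lorentzian.KerrTimeDerivative
import HarnessLib

/-!
# Sbierski's Kerr trapping theorem: the energy estimate proved, and the barrier from the Cauchy
# problem on Kerr–Schild backgrounds and the literal beam fact
(fourth companion file of `Literature/Barriers/FinalStateConjecture/TrappingDerivativeLoss.lean`;
family `gr`, summit `FinalStateConjecture`; namespace `Literature.Barriers.FinalStateConjecture`)

`TrappingDerivativeLossInputs.lean` reduces Sbierski's localised solutions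
(`SbierskiKerrLocalisedSolutions`, Anal. PDE 8 (2015), Thm. 5.1 with §7A), hence the barrier
`SbierskiTrappingObstruction` (Thm. 7.4 in the data-localised reading), to (A) the Cauchy problem
*with the energy estimate* for `□_g` on the Kerr exterior (`KerrWaveCauchyEnergyEstimate`) and (B)
coordinate-energy Gaussian beams (`SbierskiKerrGaussianBeams`); `TrappingDerivativeLossBeams.lean`
proves (B) from the literal beam fact `SbierskiKerrTrappedGeodesicBeams` (§3–§4 beams along the §7A
geodesic, in Sbierski's own `N`-energy). This file **removes the energy estimate from the trust
base**: the barrier now follows from the two canonical named facts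

* `KerrSchild.waveCauchyProblem` (`KerrSchildWaveCauchyProblem.lean`: Bär–Ginoux–Pfäffle 2007,
  Thm. 3.2.11 with Choquet-Bruhat–Cotsakis 2002, Thm. 2.1 — the Cauchy problem with domain of
  dependence on generalised Kerr–Schild backgrounds over `ℝ⁴`, shared with the Aretakis barrier), and
* `SbierskiKerrTrappedGeodesicBeams` (Sbierski §3–§4, §7A),

through `SbierskiTrappingObstruction.of_waveCauchyProblem_of_trappedGeodesicBeams`.

## Contents

* `SbierskiKerrTrappedGeodesicBeams.gaussianBeams_uniformSupport` — the coordinate-energy beam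
  statement with the compact support chosen *before* the accuracy `ε` (as printed: "`u_λ` is
  supported in `𝒩`" for every `λ`, proof of Thm. 2.1), **proved** from
  `SbierskiKerrTrappedGeodesicBeams` (the construction of
  `SbierskiKerrGaussianBeams.of_trappedGeodesicBeams` verbatim, whose cut-off set
  `{−2 ≤ t* ≤ T + 2} ∩ {‖y‖ ≤ R} ∩ {r ≥ r₊ + δ}` does not depend on `ε`) — a theorem about the
  literal beam fact, not a named statement (History below).
* `kerr_energyEstimate_core`, `kerr_localEnergyEstimate_of_waveCauchyProblem` (A′) and
  `KerrWaveCauchyEnergyEstimate.of_waveCauchyProblem` (A) — **proved**: every `C^∞` function `u`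
  on the exterior chart vanishing off a compact `S` is matched by a `C^∞` solution `ψ` of
  `□_{g_{M,a}} ψ = 0` on the whole chart with the Cauchy data of `u` on `{t* = 0}` and
  `sliceEnergy (ψ − u) τ ≤ K · slabSqNorm (□u) T`, `0 ≤ τ ≤ T`. Proof: solve on the surgered
  background `Kerr.surgeryBackground M a r₊` with the data of the zero extension `ū`
  (`KerrSchild.waveCauchyProblem`), and apply the proved energy estimate
  `KerrSchild.Background.lintegral_energy_estimate` (`KerrSchildEnergyEstimate.lean`: multiplier
  `N = −(dt)♯`, Grönwall) to `W = u_B − ū`: zero data, support over the slab in the cylinder of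
  radius `ρ = R_S + |T| + 1` (cone hull of the data), `□_B W = −𝟙_{r > r₊} □_g u`. The constant is
  `K(T) = 18 (1 + Φ)² e^{(1 + 192 (1 + Φ) D) T}`, `Φ = 4M/r₊`, `D` a bound for `|∂g⁻¹|` of the
  background: in (A′) a bound on the compact `{0 ≤ t ≤ T} ∩ {‖x⃗‖ ≤ ρ}` (so `K = K(S, T)`), in
  (A) the *global* bound of `KerrSurgeryBackgroundBounds.lean`
  (`Kerr.exists_bound_fderiv_surgeryBackground_inverseMetric`), which makes `K(T)` independent of
  the support as in the printed statement (Thm. 2.1's uniformity condition holds for `t*`,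
  `N = −(dt*)♯` on Kerr). This **discharges the named fact (A) `KerrWaveCauchyEnergyEstimate`
  relative to `KerrSchild.waveCauchyProblem`**.
* `SbierskiKerrLocalisedSolutions.of_waveCauchyProblem_of_trappedGeodesicBeams` — (A′) + the
  uniform-support beams ⟹ Thm. 5.1 rendered, from `KerrSchild.waveCauchyProblem` and
  `SbierskiKerrTrappedGeodesicBeams` (the proof of `SbierskiKerrLocalisedSolutions.of_inputs` with
  `S`, then `K(S, T)`, then `ε`, then the beam), and its corollaries for
  `SbierskiTrappingObstruction`, `SbierskiKerrTrappingLED`.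

Consequently every named statement of the `TrappingDerivativeLoss*` files is derived from the two
canonical facts: (A) from `KerrSchild.waveCauchyProblem`, (B) from
`SbierskiKerrTrappedGeodesicBeams` (`SbierskiKerrGaussianBeams.of_trappedGeodesicBeams`,
`TrappingDerivativeLossBeams.lean`), the localised solutions and the barrier from both (also
through (A) + (B), `…of_waveCauchyProblem_of_gaussianBeams`).

**History (D-0026 review of a decomposition child).** The first version of this file recorded the
uniform-support beam statement as an intermediate named fact `SbierskiKerrGaussianBeamsUniform`
(B′), with the proved implications (B′) ⟹ (B) and `SbierskiKerrTrappedGeodesicBeams` ⟹ (B′), and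
fed (B′) to the (A′) route. The three conditions of the proof of Thm. 2.1 are internal to that
proof, not a printed theorem, so (B′) cites the same locus as (B); it was never a leaf of the trust
base (derived from the literal beam fact), it is not needed on the (A) + (B) route once (A) holds
with a support-independent constant, and as a standalone fact it is as large as the Gaussian-beam
theory of Part I of the paper (the canonical fact `KerrNullGeodesicGaussianBeams` of
`TrappingDerivativeLossGeodesicBeams.lean`, from which `SbierskiKerrTrappedGeodesicBeams` follows).
It was therefore merged back: the `def` is retired, its content is the theorem
`SbierskiKerrTrappedGeodesicBeams.gaussianBeams_uniformSupport`, and the (A′) route takes the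
literal beam fact directly.

## References

* J. Sbierski, *Characterisation of the energy of Gaussian beams on Lorentzian manifolds: with
  applications to black hole spacetimes*, Anal. PDE 8 (2015) 1379–1420 (arXiv:1311.2477): §2,
  proof of Thm. 2.1 (the three conditions on `u_λ`; "(M, g) globally hyperbolic ⟹ well-posed
  initial value problem"; the energy estimate "see for example [Taylor], chapter 2.8"), Thm. 5.1,
  Thm. 5.5, §7A, Thm. 7.4 (key `Sbierski2015`).
* C. Bär, N. Ginoux, F. Pfäffle, *Wave equations on Lorentzian manifolds and quantization*, EMS 2007
  (arXiv:0806.1036), Thm. 3.2.11 (key `BarGinouxPfaffle2007`).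
* S. Alinhac, *Hyperbolic partial differential equations*, Springer 2009, Ch. 7.
-/

noncomputable section

open Set Filter
open scoped Manifold ContDiff ENNReal Topology

namespace Literature.Barriers.FinalStateConjecture

open Literature.Geometry.Lorentzian
open _root_.MeasureTheory Metric

/-! ### Gaussian beams with `λ`-uniform support, from the literal beam fact -/

/-- **Sbierski's Gaussian beams along the trapped null geodesics of Kerr in the coordinate
energies, with support uniform in the frequency, from the literal beam fact** (proved rendering:
the coordinate-energy beam statement `SbierskiKerrGaussianBeams` of
`TrappingDerivativeLossInputs.lean` with its compact-support clause moved in front of the accuracy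
`ε`). Sbierski, Anal. PDE 8 (2015), proof of Thm. 2.1: the beams `u_λ = a_𝒩 e^{iλφ}` along `γ`
are, for *every* `λ`, "supported in `𝒩`", the neighbourhood `𝒩` of `γ` being fixed before `λ`
(third condition), while `‖□ũ_λ‖_{L²(R_{[0,T]})} → 0` as `λ → ∞` (first and second conditions);
§7A: `γ = γ_{r₀}` trapped in the domain of outer communications of Kerr, `0 ≤ a ≤ m`, `m ≠ 0`.
**Statement** (given `SbierskiKerrTrappedGeodesicBeams`): for `0 < M`, `0 ≤ a ≤ M` there is `R₀`
such that for every `R ≥ R₀` there are `c > 0` and `C` such that for every `T ≥ 0` there is a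
compact subset `S` of the chart `Kerr.exterior M a` such that for every `ε > 0` some `C^∞`
function `u` on the chart vanishing off `S`, with `u = 0`, `du = 0` at the points of `{t* = 0}`
with `‖y‖ > R`, has `sliceEnergy u 0 ≤ C`, `slabSqNorm (□_{g_{M,a}} u) T ≤ ε` and
`c ≤ localSliceEnergy u τ R` for all `0 ≤ τ ≤ T`. **Proof:** the construction of
`SbierskiKerrGaussianBeams.of_trappedGeodesicBeams` (`TrappingDerivativeLossBeams.lean`: the beam
for `μ := min(c₁/2, ε)` cut off smoothly in `t*` outside `[−1, T + 1]`, `c := c₁/30`,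
`C := 4C₁`), with the one observation that the compact set
`{−2 ≤ t* ≤ T + 2} ∩ {‖y‖ ≤ R} ∩ {r ≥ r₊ + δ}` off which the cut-off beam vanishes depends on
`T`, `R` and the width `δ` of the prescribed neighbourhood `𝒩` only — not on the accuracy `μ`,
i.e. not on the frequency `λ` ("`u_λ` is supported in `𝒩`" for all `λ`). This theorem replaces
the intermediate named statement `SbierskiKerrGaussianBeamsUniform` (B′) of the first version of
the file (module docstring, History). [cite: Sbierski2015, proof of Thm. 2.1 (three conditions) with §7A] -/
theorem SbierskiKerrTrappedGeodesicBeams.gaussianBeams_uniformSupport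
    (hB : SbierskiKerrTrappedGeodesicBeams) [Kerr.Facts] [Kerr.SliceFacts] {M a : ℝ}
    (hM : 0 < M) (ha₀ : 0 ≤ a) (haM : a ≤ M) :
    ∃ R₀ : ℝ, ∀ R : ℝ, R₀ ≤ R →
      ∃ c C : ℝ, 0 < c ∧ ∀ T : ℝ, 0 ≤ T →
        ∃ S : Set (Kerr.exterior M a), IsCompact S ∧ ∀ ε : ℝ, 0 < ε →
          ∃ u : Kerr.exterior M a → ℝ,
            ContMDiff 𝓘(ℝ, E4) 𝓘(ℝ, ℝ) ∞ u ∧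
            (∀ x, x ∉ S → u x = 0) ∧
            (∀ x : Kerr.exterior M a, (x : E4) 0 = 0 → R < E4.spatialNorm (x : E4) →
              u x = 0 ∧ mfderiv 𝓘(ℝ, E4) 𝓘(ℝ, ℝ) u x = 0) ∧
            sliceEnergy (Kerr.exterior M a) u 0 ≤ ENNReal.ofReal C ∧
            slabSqNorm (Kerr.exterior M a) (fun x ↦
                (Kerr.smoothMetric M a (Kerr.rPlus M a)).toPseudoRiemannianMetric.dalembertian u x)
              T ≤ ENNReal.ofReal ε ∧
            ∀ τ : ℝ, 0 ≤ τ → τ ≤ T →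
              ENNReal.ofReal c ≤ localSliceEnergy (Kerr.exterior M a) u τ R := by
  obtain ⟨R₀, hR₀⟩ := hB M a hM ha₀ haM
  refine ⟨R₀, fun R hR ↦ ?_⟩
  obtain ⟨e, c₁, C₁, δ, hc₁, hδ, hebd, hbeam⟩ := hR₀ R hR
  refine ⟨c₁ / 30, 4 * C₁, by positivity, fun T hT ↦ ?_⟩
  -- ### the compact set, fixed before the accuracy
  set K : Set E4 := {y : E4 | -2 ≤ y 0 ∧ y 0 ≤ T + 2 ∧ E4.spatialNorm y ≤ R ∧
    Kerr.rPlus M a + δ ≤ Kerr.radius a y} with hK_def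
  have hKsub : K ⊆ (Kerr.exterior M a : Set E4) := by
    intro y hy
    rw [SetLike.mem_coe, Kerr.mem_exterior, max_lt_iff]
    have hrp := rPlus_pos_of_pos hM a
    exact ⟨by linarith [hy.2.2.2], by linarith [hy.2.2.2]⟩
  have hKclosed : IsClosed K := by
    have hc0 : Continuous fun y : E4 ↦ y 0 := (Kerr.contDiff_coord 0 (n := 0)).continuous
    have hcs : Continuous fun y : E4 ↦ E4.spatialNorm y := by
      unfold E4.spatialNorm; fun_prop
    have hcr : Continuous fun y : E4 ↦ Kerr.radius a y := Kerr.continuous_radius a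
    refine (isClosed_le continuous_const hc0).inter ((isClosed_le hc0 continuous_const).inter
      ((isClosed_le hcs continuous_const).inter (isClosed_le continuous_const hcr)))
  have hKbdd : Bornology.IsBounded K := by
    refine (Metric.isBounded_closedBall (x := (0 : E4)) (r := T + 2 + |R|)).subset ?_
    intro y hy
    rw [Metric.mem_closedBall, dist_zero_right]
    have h0 : |y 0| ≤ T + 2 := abs_le.2 ⟨by linarith [hy.1], hy.2.1⟩
    have h1 : E4.spatialNorm y ≤ |R| := hy.2.2.1.trans (le_abs_self R)
    linarith [norm_le_abs_add_spatialNorm y]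
  have hKc : IsCompact K := Metric.isCompact_of_isClosed_isBounded hKclosed hKbdd
  refine ⟨Subtype.val ⁻¹' K, Topology.IsInducing.subtypeVal.isCompact_preimage' hKc
    (fun y hy ↦ ⟨⟨y, hKsub hy⟩, rfl⟩), fun ε hε ↦ ?_⟩
  -- ### Sbierski's accuracy and the beam (as in `SbierskiKerrGaussianBeams.of_trappedGeodesicBeams`)
  set μ : ℝ := min (c₁ / 2) ε with hμ_def
  have hμ₀ : 0 < μ := lt_min (by positivity) hε
  have hμ₁ : μ ≤ c₁ / 2 := min_le_left _ _
  have hμ₂ : μ ≤ ε := min_le_right _ _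
  obtain ⟨u, hu, hsupp, hbox, hE₀, hEτ⟩ := hbeam T hT μ hμ₀
  have hsuppR : ∀ x : Kerr.exterior M a, R ≤ E4.spatialNorm (x : E4) → u x = 0 :=
    fun x hx ↦ hsupp x (Or.inl hx)
  -- the cut-off beam
  set v : Kerr.exterior M a → ℝ := fun x ↦ timeCutoff T ((x : E4) 0) * u x with hv_def
  set Φu : E4 → ℝ := Function.extend Subtype.val u (0 : E4 → ℝ) with hΦu
  have hrep_u : ∀ y : Kerr.exterior M a, u y = Φu y := fun y ↦ (extend_val_apply u y).symm
  set Φv : E4 → ℝ := fun y ↦ timeCutoff T (y 0) * Φu y with hΦv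
  have hrep_v : ∀ y : Kerr.exterior M a, v y = Φv y := fun y ↦ by
    simp only [hv_def, hΦv, hrep_u]
  have hv : ContMDiff 𝓘(ℝ, E4) 𝓘(ℝ, ℝ) ∞ v := by
    intro y
    refine (OpensChart.contMDiffAt_iff y v Φv hrep_v).2 ?_
    have h1 : ContDiffAt ℝ ∞ (fun z : E4 ↦ timeCutoff T (z 0)) y :=
      ((contDiff_timeCutoff T).comp (Kerr.contDiff_coord 0)).contDiffAt
    exact h1.mul ((OpensChart.contMDiffAt_iff y u Φu hrep_u).1 (hu y))
  have hvu : ∀ x : Kerr.exterior M a, -1 < (x : E4) 0 → (x : E4) 0 < T + 1 → v =ᶠ[𝓝 x] u := by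
    intro x hx₁ hx₂
    have hO : IsOpen {z : Kerr.exterior M a | -1 < (z : E4) 0 ∧ (z : E4) 0 < T + 1} := by
      have hc : Continuous fun z : Kerr.exterior M a ↦ (z : E4) 0 := by fun_prop
      exact (isOpen_lt continuous_const hc).inter (isOpen_lt hc continuous_const)
    filter_upwards [hO.mem_nhds ⟨hx₁, hx₂⟩] with z hz
    simp only [hv_def, timeCutoff_eq_one hz.1.le hz.2.le, one_mul]
  have hvu_mfderiv : ∀ x : Kerr.exterior M a, -1 < (x : E4) 0 → (x : E4) 0 < T + 1 →
      mfderiv 𝓘(ℝ, E4) 𝓘(ℝ, ℝ) v x = mfderiv 𝓘(ℝ, E4) 𝓘(ℝ, ℝ) u x :=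
    fun x hx₁ hx₂ ↦ (hvu x hx₁ hx₂).mfderiv_eq
  have hvR : ∀ x : Kerr.exterior M a, R ≤ E4.spatialNorm (x : E4) → v x = 0 := fun x hx ↦ by
    simp only [hv_def, hsuppR x hx, mul_zero]
  have hinf : (∞ : ℕ∞ω) ≠ 0 := by simp
  refine ⟨v, hv, ?_, ?_, ?_, ?_, ?_⟩
  · -- off `K` the cut-off beam vanishes
    intro x hx
    simp only [Set.mem_preimage, hK_def, Set.mem_setOf_eq, not_and_or, not_le] at hx
    rcases hx with h | h | h | h
    · simp only [hv_def, timeCutoff_eq_zero_of_le h.le, zero_mul]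
    · simp only [hv_def, timeCutoff_eq_zero_of_ge h.le, zero_mul]
    · exact hvR x h.le
    · simp only [hv_def, hsupp x (Or.inr h), mul_zero]
  · intro x _ hxR
    exact eq_zero_and_mfderiv_eq_zero_of_vanishing hvR hxR
  · have hT1 : (0 : ℝ) < T + 1 := by linarith
    calc sliceEnergy (Kerr.exterior M a) v 0
        = sliceEnergy (Kerr.exterior M a) u 0 :=
          sliceEnergy_congr_of_mfderiv_eq hinf hv hu 0 fun x hx ↦
            hvu_mfderiv x (by rw [hx]; norm_num) (by rw [hx]; exact hT1)
      _ ≤ 4 * Kerr.leafFlux M a 0 u 0 := Kerr.sliceEnergy_le_four_mul_leafFlux hM.le u 0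
      _ = ENNReal.ofReal (4 * e 0) := by
          rw [hE₀, ENNReal.ofReal_mul (by norm_num), ENNReal.ofReal_ofNat]
      _ ≤ ENNReal.ofReal (4 * C₁) := ENNReal.ofReal_le_ofReal (by linarith [(hebd 0 le_rfl).2])
  · have heq : slabSqNorm (Kerr.exterior M a) (fun x ↦
          (Kerr.smoothMetric M a (Kerr.rPlus M a)).toPseudoRiemannianMetric.dalembertian v x) T =
        slabSqNorm (Kerr.exterior M a) (fun x ↦
          (Kerr.smoothMetric M a (Kerr.rPlus M a)).toPseudoRiemannianMetric.dalembertian u x) T :=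
      slabSqNorm_congr_of_eqOn_slab fun x hx0 hxT ↦
        dalembertian_congr_of_eventuallyEq (hv.of_le (by norm_cast))
          (hu.of_le (by norm_cast)) (hvu x (by linarith) (by linarith))
    rw [heq]
    exact hbox.trans (ENNReal.ofReal_le_ofReal hμ₂)
  · intro τ hτ₀ hτT
    obtain ⟨hfin, habs⟩ := hEτ τ hτ₀ hτT
    have heτ : c₁ ≤ e τ := (hebd τ hτ₀).1
    have hloc : localSliceEnergy (Kerr.exterior M a) v τ R =
        localSliceEnergy (Kerr.exterior M a) u τ R :=
      localSliceEnergy_congr_of_mfderiv_eq hinf hv hu τ R fun x hx ↦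
        hvu_mfderiv x (by rw [hx]; linarith) (by rw [hx]; linarith)
    rw [hloc]
    have hflux : ENNReal.ofReal (c₁ / 2) ≤ Kerr.localLeafFlux M a 0 u τ R := by
      rw [← leafFlux_zero_height_eq_localLeafFlux hsuppR τ, ← ENNReal.ofReal_toReal hfin]
      refine ENNReal.ofReal_le_ofReal ?_
      have := (abs_sub_lt_iff.1 habs).2
      linarith
    have h15 : ENNReal.ofReal (c₁ / 2) ≤
        ENNReal.ofReal 15 * localSliceEnergy (Kerr.exterior M a) u τ R := by
      rw [ENNReal.ofReal_ofNat]
      exact hflux.trans (localLeafFlux_zero_height_le_localSliceEnergy_of_pos hM u τ R)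
    have h := ofReal_div_le_of_le_mul (by norm_num : (0 : ℝ) < 15) h15
    convert h using 2
    ring

/-! ### Calculus of zero extensions and of the divergence-form wave operator -/

section Extension

variable {U : TopologicalSpace.Opens E4}

/-- The zero extension of a function on the chart vanishing off a compact subset `S` vanishes
identically near every point of `E4` outside the image of `S`. [folklore] -/
theorem extend_val_eventuallyEq_zero {u : U → ℝ} {S : Set U} (hS : IsCompact S)
    (h0 : ∀ x, x ∉ S → u x = 0) {x : E4} (hx : x ∉ Subtype.val '' S) :
    Function.extend Subtype.val u (0 : E4 → ℝ) =ᶠ[𝓝 x] fun _ ↦ 0 := by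
  have hclosed : IsClosed (Subtype.val '' S : Set E4) := (hS.image continuous_subtype_val).isClosed
  filter_upwards [hclosed.isOpen_compl.mem_nhds hx] with z hz
  by_cases hzU : ∃ w : U, (w : E4) = z
  · obtain ⟨w, rfl⟩ := hzU
    rw [extend_val_apply]
    exact h0 w fun hw ↦ hz ⟨w, hw, rfl⟩
  · exact Function.extend_apply' _ _ _ hzU

/-- **The zero extension of a `C^n` function on the chart vanishing off a compact subset is `C^n`
on all of `E4`** (`C^n` at chart points, `OpensChart.contMDiffAt_iff`; identically zero near the
other points). [folklore] -/
theorem contDiff_extend_val {u : U → ℝ} {n : ℕ∞ω} (hu : ContMDiff 𝓘(ℝ, E4) 𝓘(ℝ, ℝ) n u)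
    {S : Set U} (hS : IsCompact S) (h0 : ∀ x, x ∉ S → u x = 0) :
    ContDiff ℝ n (Function.extend Subtype.val u (0 : E4 → ℝ)) := by
  rw [contDiff_iff_contDiffAt]
  intro x
  by_cases hx : x ∈ Subtype.val '' S
  · obtain ⟨w, -, rfl⟩ := hx
    exact contDiffAt_extend hu w
  · exact (contDiffAt_const (c := (0 : ℝ))).congr_of_eventuallyEq
      (extend_val_eventuallyEq_zero hS h0 hx)

end Extension

/-- The divergence-form wave operator of a function vanishing identically near `x` vanishes at
`x`. [folklore] -/
theorem waveOperator_eq_zero_of_eventuallyEq_zero {G : E4 → Fin 4 → Fin 4 → ℝ} {f : E4 → ℝ}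
    {x : E4} (h : f =ᶠ[𝓝 x] fun _ ↦ 0) : KerrSchild.waveOperator G f x = 0 := by
  obtain ⟨O, hOf, hO, hxO⟩ := _root_.eventually_nhds_iff.1 h
  have hdf : ∀ z ∈ O, fderiv ℝ f z = 0 := fun z hz ↦
    fderiv_eq_zero_of_forall_mem_eq_zero hO hOf hz
  unfold KerrSchild.waveOperator
  refine Finset.sum_eq_zero fun μ _ ↦ ?_
  have hinner : (fun y ↦ ∑ ν, G y μ ν * fderiv ℝ f y (E4.basisVector ν)) =ᶠ[𝓝 x] fun _ ↦ 0 := by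
    filter_upwards [hO.mem_nhds hxO] with z hz
    simp [hdf z hz]
  rw [hinner.fderiv_eq]
  simp

/-- The divergence-form wave operator is additive: `□_G (f − g) = □_G f − □_G g` for `C²`
functions and differentiable coefficients. [folklore] -/
theorem waveOperator_sub {G : E4 → Fin 4 → Fin 4 → ℝ} (hG : ∀ μ ν, Differentiable ℝ fun y ↦ G y μ ν)
    {f g : E4 → ℝ} (hf : ContDiff ℝ 2 f) (hg : ContDiff ℝ 2 g) (x : E4) :
    KerrSchild.waveOperator G (f - g) x =
      KerrSchild.waveOperator G f x - KerrSchild.waveOperator G g x := by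
  unfold KerrSchild.waveOperator
  rw [← Finset.sum_sub_distrib]
  refine Finset.sum_congr rfl fun μ _ ↦ ?_
  have hpf : ∀ ν, ContDiff ℝ 1 fun y ↦ fderiv ℝ f y (E4.basisVector ν) :=
    fun ν ↦ KerrSchild.Background.contDiff_partial hf _
  have hpg : ∀ ν, ContDiff ℝ 1 fun y ↦ fderiv ℝ g y (E4.basisVector ν) :=
    fun ν ↦ KerrSchild.Background.contDiff_partial hg _
  have hfun : (fun y ↦ ∑ ν, G y μ ν * fderiv ℝ (f - g) y (E4.basisVector ν)) =
      (fun y ↦ ∑ ν, G y μ ν * fderiv ℝ f y (E4.basisVector ν)) -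
        fun y ↦ ∑ ν, G y μ ν * fderiv ℝ g y (E4.basisVector ν) := by
    funext y
    simp only [Pi.sub_apply, fderiv_sub (hf.differentiable (by simp) y) (hg.differentiable (by simp) y),
      sub_apply, mul_sub, Finset.sum_sub_distrib]
  rw [hfun, fderiv_sub]
  · rfl
  · exact (DifferentiableAt.fun_sum fun ν _ ↦ ((hG μ ν) x).mul ((hpf ν).differentiable one_ne_zero x))
  · exact (DifferentiableAt.fun_sum fun ν _ ↦ ((hG μ ν) x).mul ((hpg ν).differentiable one_ne_zero x))

/-! ### (A) The Cauchy problem and the energy estimate, from `waveCauchyProblem` -/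

/-- **Core of (A)/(A′): the solution with the data of `u` and its energy estimate, with the explicit
constant of `KerrSchild.Background.lintegral_energy_estimate`.** For `0 < M`, a compact subset `S` of
the exterior chart and a `C^∞` function `u` vanishing off `S`, there is a `C^∞` solution `ψ` of
`□_{g_{M,a}} ψ = 0` on the whole chart with the Cauchy data of `u` on `{t* = 0}` (solve on the
surgered background `Kerr.surgeryBackground M a r₊` with the data of the zero extension `ū`,
`KerrSchild.waveCauchyProblem`) such that for every `T`, every radius `ρ` with
`‖z‖ + |T| + 1 ≤ ρ` on `S`, and every bound `D` for `|∂g⁻¹|` of the background on the cylinder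
`{0 ≤ t ≤ T} ∩ {‖x⃗‖ ≤ ρ}`, one has for `0 ≤ τ ≤ T`
`sliceEnergy (ψ − u) τ ≤ 18 (1 + Φ)² e^{(1 + 192 (1 + Φ) D) T} · slabSqNorm (□u) T`, `Φ = 4M/r₊`
(the energy estimate applied to `W = u_B − ū`: zero data, support over the slab in the cylinder —
cone hull of the data —, `□_B W = −𝟙_{r > r₊} □_g u`). Sbierski, Anal. PDE 8 (2015), proof of
Thm. 2.1. [cite: Sbierski2015, §2 proof of Thm. 2.1 (energy estimate); BarGinouxPfaffle2007 Thm. 3.2.11] -/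
theorem kerr_energyEstimate_core (h : KerrSchild.waveCauchyProblem) [Kerr.Facts] [Kerr.SliceFacts]
    {M a : ℝ} (hM : 0 < M) {S : Set (Kerr.exterior M a)} (hS : IsCompact S)
    {u : Kerr.exterior M a → ℝ} (hu : ContMDiff 𝓘(ℝ, E4) 𝓘(ℝ, ℝ) ∞ u)
    (hu0 : ∀ x, x ∉ S → u x = 0) :
    ∃ ψ : Kerr.exterior M a → ℝ, ContMDiff 𝓘(ℝ, E4) 𝓘(ℝ, ℝ) ∞ ψ ∧
      (∀ x, (Kerr.smoothMetric M a (Kerr.rPlus M a)).toPseudoRiemannianMetric.dalembertian ψ x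
        = 0) ∧
      (∀ x : Kerr.exterior M a, (x : E4) 0 = 0 →
        ψ x = u x ∧ mfderiv 𝓘(ℝ, E4) 𝓘(ℝ, ℝ) ψ x = mfderiv 𝓘(ℝ, E4) 𝓘(ℝ, ℝ) u x) ∧
      ∀ (T ρ D : ℝ), 0 ≤ D → (∀ z ∈ S, ‖(z : E4)‖ + |T| + 1 ≤ ρ) →
        (∀ x : E4, 0 ≤ x 0 → x 0 ≤ T → E4.spatialNorm x ≤ ρ → ∀ μ α β,
          |fderiv ℝ (fun y ↦ (Kerr.surgeryBackground M a (Kerr.rPlus M a) hM.le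
            (rPlus_pos_of_pos hM a)).inverseMetric y α β) x (E4.basisVector μ)| ≤ D) →
        ∀ τ : ℝ, 0 ≤ τ → τ ≤ T →
          sliceEnergy (Kerr.exterior M a) (ψ - u) τ ≤
            ENNReal.ofReal (18 * (1 + 4 * M / Kerr.rPlus M a) ^ 2 *
                Real.exp ((1 + 192 * (1 + 4 * M / Kerr.rPlus M a) * D) * T)) *
              slabSqNorm (Kerr.exterior M a) (fun x ↦
                (Kerr.smoothMetric M a (Kerr.rPlus M a)).toPseudoRiemannianMetric.dalembertian u x) T := by
  have hrp : 0 < Kerr.rPlus M a := rPlus_pos_of_pos hM a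
  set B := Kerr.surgeryBackground M a (Kerr.rPlus M a) hM.le (rPlus_pos_of_pos hM a) with hB
  have hBbound : B.bound = 4 * M / Kerr.rPlus M a := rfl
  -- a radius for the support
  have hS' : IsCompact (Subtype.val '' S : Set E4) := hS.image continuous_subtype_val
  obtain ⟨R_S, hR_S⟩ := hS'.isBounded.subset_closedBall (0 : E4)
  have hRS : ∀ z ∈ S, ‖(z : E4)‖ ≤ R_S := fun z hz ↦ by
    have := hR_S ⟨z, hz, rfl⟩
    rwa [Metric.mem_closedBall, dist_zero_right] at this
  -- ### the zero extension of `u`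
  set ub : E4 → ℝ := Function.extend Subtype.val u (0 : E4 → ℝ) with hub_def
  have hrep : ∀ y : Kerr.exterior M a, u y = ub y := fun y ↦ (extend_val_apply u y).symm
  have hub : ContDiff ℝ ∞ ub := contDiff_extend_val hu hS hu0
  have hub2 : ContDiff ℝ 2 ub := hub.of_le (by norm_cast)
  have hub_near : ∀ x : E4, x ∉ Subtype.val '' S → ub =ᶠ[𝓝 x] fun _ ↦ 0 :=
    fun x hx ↦ extend_val_eventuallyEq_zero hS hu0 hx
  -- vanishing beyond any radius bounding `S`
  have hnotS : ∀ R' : ℝ, (∀ z ∈ S, ‖(z : E4)‖ ≤ R') → ∀ x : E4, R' < ‖x‖ →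
      x ∉ Subtype.val '' S := by
    rintro R' hR' x hx ⟨z, hz, hzx⟩
    have := hR' z hz
    rw [hzx] at this
    linarith
  have hub0 : ∀ R' : ℝ, (∀ z ∈ S, ‖(z : E4)‖ ≤ R') → ∀ x : E4, R' < ‖x‖ → ub x = 0 :=
    fun R' hR' x hx ↦ (hub_near x (hnotS R' hR' x hx)).self_of_nhds
  have hdub0 : ∀ R' : ℝ, (∀ z ∈ S, ‖(z : E4)‖ ≤ R') → ∀ x : E4, R' < ‖x‖ → fderiv ℝ ub x = 0 :=
    fun R' hR' x hx ↦ by rw [(hub_near x (hnotS R' hR' x hx)).fderiv_eq]; simp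
  -- ### the data
  set ψ₀ : E3 → ℝ := fun y ↦ ub (E4.ofTimeSpace 0 y) with hψ₀_def
  set ψ₁ : E3 → ℝ := fun y ↦ fderiv ℝ ub (E4.ofTimeSpace 0 y) (E4.basisVector 0) with hψ₁_def
  have hψ₀ : ContDiff ℝ ∞ ψ₀ := hub.comp (E4.contDiff_ofTimeSpace 0)
  have hψ₁ : ContDiff ℝ ∞ ψ₁ := by
    have h1 : ContDiff ℝ ∞ fun x : E4 ↦ fderiv ℝ ub x (E4.basisVector 0) :=
      contDiff_iff_contDiffAt.2 fun x ↦ contDiffAt_fderiv_apply_const_infty hub.contDiffAt _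
    exact h1.comp (E4.contDiff_ofTimeSpace 0)
  have hvan : ∀ R' : ℝ, (∀ z ∈ S, ‖(z : E4)‖ ≤ R') → ∀ y : E3, R' < ‖y‖ →
      ψ₀ y = 0 ∧ ψ₁ y = 0 := by
    intro R' hR' y hy
    have hn : R' < ‖E4.ofTimeSpace 0 y‖ :=
      hy.trans_le (by simpa using E4.spatialNorm_le_norm (E4.ofTimeSpace 0 y))
    refine ⟨hub0 R' hR' _ hn, ?_⟩
    simp only [hψ₁_def, hdub0 R' hR' _ hn]
    rfl
  have hc₀ : HasCompactSupport ψ₀ := HasCompactSupport.intro (isCompact_closedBall (0 : E3) R_S)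
    fun y hy ↦ (hvan R_S hRS y (by rwa [Metric.mem_closedBall, dist_zero_right, not_le] at hy)).1
  have hc₁ : HasCompactSupport ψ₁ := HasCompactSupport.intro (isCompact_closedBall (0 : E3) R_S)
    fun y hy ↦ (hvan R_S hRS y (by rwa [Metric.mem_closedBall, dist_zero_right, not_le] at hy)).2
  have hts : ∀ R' : ℝ, (∀ z ∈ S, ‖(z : E4)‖ ≤ R') →
      tsupport ψ₀ ∪ tsupport ψ₁ ⊆ Metric.closedBall (0 : E3) R' := by
    intro R' hR'
    refine Set.union_subset (closure_minimal (fun y hy ↦ ?_) Metric.isClosed_closedBall)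
      (closure_minimal (fun y hy ↦ ?_) Metric.isClosed_closedBall)
    · rw [Metric.mem_closedBall, dist_zero_right]
      by_contra hlt
      exact hy (hvan R' hR' y (not_le.1 hlt)).1
    · rw [Metric.mem_closedBall, dist_zero_right]
      by_contra hlt
      exact hy (hvan R' hR' y (not_le.1 hlt)).2
  -- ### solve the Cauchy problem on the surgered background
  obtain ⟨uB, huB, hsol, hdata, hcone⟩ := h B ψ₀ ψ₁ hψ₀ hψ₁ hc₀ hc₁
  have huB2 : ContDiff ℝ 2 uB := huB.of_le (by norm_cast)
  -- the difference `W = u_B − ū`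
  set W : E4 → ℝ := uB - ub with hW_def
  have hW2 : ContDiff ℝ 2 W := huB2.sub hub2
  -- data of `W` vanish: `du_B = dū` on the initial slice
  have hdWslice : ∀ y : E3, fderiv ℝ uB (E4.ofTimeSpace 0 y) = fderiv ℝ ub (E4.ofTimeSpace 0 y) :=
    E4.fderiv_eq_of_data_eq (huB.differentiable (by simp)) (hub.differentiable (by simp))
      (fun y ↦ (hdata y).1) (fun y ↦ (hdata y).2)
  -- ### the solution on the chart
  have hinf : (∞ : ℕ∞ω) ≠ 0 := by simp
  set ψf : Kerr.exterior M a → ℝ := fun x ↦ uB x with hψf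
  have hrepψ : ∀ y : Kerr.exterior M a, ψf y = uB y := fun _ ↦ rfl
  -- on the chart the background operator is `□_g`
  have hboxchart : ∀ (f : Kerr.exterior M a → ℝ) (F : E4 → ℝ), (∀ y, f y = F y) →
      ∀ x : Kerr.exterior M a, ContDiffAt ℝ 2 F x →
        (Kerr.smoothMetric M a (Kerr.rPlus M a)).toPseudoRiemannianMetric.dalembertian f x =
          KerrSchild.waveOperator B.inverseMetric F x := by
    intro f F hfF x hF
    exact (Kerr.dalembertian_eq_waveOperator M a (Kerr.rPlus M a) hfF x hF).trans
      (KerrSchild.waveOperator_congr_of_eventuallyEq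
        (Kerr.surgeryBackground_inverseMetric_eventuallyEq M a hM.le hrp x) F)
  refine ⟨ψf, fun x ↦ ?_, fun x ↦ ?_, fun x hx0 ↦ ?_, fun T ρ D hD0 hSρ hD τ hτ0 hτT ↦ ?_⟩
  · exact (OpensChart.contMDiffAt_iff x ψf uB hrepψ).mpr huB.contDiffAt
  · rw [hboxchart ψf uB hrepψ x huB2.contDiffAt]
    exact hsol x
  · have hx : E4.ofTimeSpace 0 (E4.spatial (x : E4)) = x := Kerr.ofTimeSpace_spatial_eq hx0
    obtain ⟨h1, -⟩ := hdata (E4.spatial (x : E4))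
    rw [hx] at h1
    refine ⟨?_, ?_⟩
    · rw [hrepψ, h1]
      show ub (E4.ofTimeSpace 0 (E4.spatial (x : E4))) = u x
      rw [hx, ← hrep]
    · rw [OpensChart.mfderiv_eq x ψf uB hrepψ ((huB.differentiable (by simp)) _),
        ← fderiv_extend_val_eq_mfderiv hinf hu x]
      have := hdWslice (E4.spatial (x : E4))
      rwa [hx] at this
  · -- ### the energy estimate for `W` on `[0, T]`
    have hT : 0 ≤ T := hτ0.trans hτT
    -- the radius `R' = ρ − |T| − 1` bounds `S`
    set R' : ℝ := ρ - |T| - 1 with hR'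
    have hR'S : ∀ z ∈ S, ‖(z : E4)‖ ≤ R' := fun z hz ↦ by linarith [hSρ z hz]
    -- support of `W` over the slab
    have hsuppW : ∀ x : E4, -1 < x 0 → x 0 < T + 1 → ρ < E4.spatialNorm x → W x = 0 := by
      intro x h1 h2 h3
      have hxn : R' < ‖x‖ := by
        have := E4.spatialNorm_le_norm x
        linarith [abs_nonneg T]
      have hub0x : ub x = 0 := hub0 R' hR'S x hxn
      have huB0x : uB x = 0 := by
        refine hcone x fun y hy ↦ ?_
        have hyR : ‖y‖ ≤ R' := by
          have := hts R' hR'S hy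
          rwa [Metric.mem_closedBall, dist_zero_right] at this
        have hx0 : |x 0| < |T| + 1 :=
          abs_lt.2 ⟨by linarith [abs_nonneg T], by linarith [le_abs_self T]⟩
        have hdist : E4.spatialNorm x - ‖y‖ ≤ dist (E4.spatial x) y := by
          have := norm_sub_norm_le (E4.spatial x) y
          rw [← dist_eq_norm] at this
          exact this
        linarith
      simp [hW_def, hub0x, huB0x]
    have hest := B.lintegral_energy_estimate hW2 hD0 hsuppW hD hτ0 hτT
    -- the initial energy of `W` vanishes
    have hE0 : ∫⁻ y : E3, ENNReal.ofReal
        (∑ μ, fderiv ℝ W (E4.ofTimeSpace 0 y) (E4.basisVector μ) ^ 2) = 0 := by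
      refine (lintegral_congr fun y ↦ ?_).trans (lintegral_zero (μ := (volume : Measure E3)))
      have hdW : fderiv ℝ W (E4.ofTimeSpace 0 y) = 0 := by
        rw [hW_def, fderiv_sub ((huB.differentiable (by simp)) _) ((hub.differentiable (by simp)) _),
          hdWslice y, sub_self]
      simp [hdW]
    rw [hE0, zero_add] at hest
    -- `sliceEnergy (ψ − u) τ ≤ ∫⁻ ∑ (∂W)²(τ, ·)`
    have hslice : sliceEnergy (Kerr.exterior M a) (ψf - u) τ ≤
        ∫⁻ y : E3, ENNReal.ofReal (∑ μ, fderiv ℝ W (E4.ofTimeSpace τ y) (E4.basisVector μ) ^ 2) := by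
      unfold sliceEnergy
      refine lintegral_mono fun y ↦ ?_
      by_cases hy : E4.ofTimeSpace τ y ∈ Kerr.exterior M a
      · rw [Set.indicator_of_mem (show y ∈ {y : E3 | E4.ofTimeSpace τ y ∈ Kerr.exterior M a} from hy)]
        refine le_of_eq (congrArg ENNReal.ofReal ?_)
        -- the representative of `ψ − u` agrees with `W` near the chart point
        have hag : Function.extend Subtype.val (ψf - u) (0 : E4 → ℝ) =ᶠ[𝓝 (E4.ofTimeSpace τ y)] W := by
          filter_upwards [(Kerr.exterior M a).isOpen.mem_nhds hy] with z hz
          rw [extend_val_apply _ ⟨z, hz⟩]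
          simp [hW_def, hψf, hrep ⟨z, hz⟩]
        unfold coordEnergyDensity
        exact Finset.sum_congr rfl fun μ _ ↦ by rw [hag.fderiv_eq]
      · rw [Set.indicator_of_notMem (show y ∉ {y : E3 | E4.ofTimeSpace τ y ∈ Kerr.exterior M a} from hy)]
        exact zero_le
    -- `∫⁻_{slab} (□_B W)² ≤ slabSqNorm (□_g u) T`
    have hGdiff : ∀ μ ν, Differentiable ℝ fun y ↦ B.inverseMetric y μ ν :=
      fun μ ν ↦ (B.contDiff_inverseMetric μ ν).differentiable (by simp)
    have hslab : ∫⁻ x in {x : E4 | x 0 ∈ Set.Icc 0 T},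
        ENNReal.ofReal (KerrSchild.waveOperator B.inverseMetric W x ^ 2) ≤
        slabSqNorm (Kerr.exterior M a) (fun x ↦
          (Kerr.smoothMetric M a (Kerr.rPlus M a)).toPseudoRiemannianMetric.dalembertian u x) T := by
      have hmeas : MeasurableSet {x : E4 | x 0 ∈ Set.Icc 0 T} :=
        (E4.dx 0).continuous.measurable measurableSet_Icc
      rw [slabSqNorm, ← lintegral_indicator hmeas]
      refine lintegral_mono fun x ↦ ?_
      by_cases hxt : x ∈ {x : E4 | x 0 ∈ Set.Icc 0 T}
      · rw [Set.indicator_of_mem hxt]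
        have hbox : KerrSchild.waveOperator B.inverseMetric W x =
            -KerrSchild.waveOperator B.inverseMetric ub x := by
          rw [hW_def, waveOperator_sub hGdiff huB2 hub2, hsol x, zero_sub]
        by_cases hxU : x ∈ (Kerr.exterior M a : Set E4)
        · have hxs : x ∈ {x : E4 | x ∈ (Kerr.exterior M a : Set E4) ∧ 0 ≤ x 0 ∧ x 0 ≤ T} :=
            ⟨hxU, hxt.1, hxt.2⟩
          rw [Set.indicator_of_mem hxs, extend_val_apply _ ⟨x, hxU⟩]
          refine le_of_eq (congrArg ENNReal.ofReal ?_)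
          rw [hbox, neg_sq]
          congr 1
          exact (hboxchart u ub hrep ⟨x, hxU⟩ hub2.contDiffAt).symm
        · have hxS : x ∉ Subtype.val '' S := fun ⟨w, _, hw⟩ ↦ hxU (hw ▸ w.2)
          rw [hbox, waveOperator_eq_zero_of_eventuallyEq_zero (hub_near x hxS), neg_zero]
          simp
      · rw [Set.indicator_of_notMem hxt]
        exact zero_le
    calc sliceEnergy (Kerr.exterior M a) (ψf - u) τ
        ≤ ∫⁻ y : E3, ENNReal.ofReal (∑ μ, fderiv ℝ W (E4.ofTimeSpace τ y) (E4.basisVector μ) ^ 2) :=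
          hslice
      _ ≤ ENNReal.ofReal (18 * (1 + B.bound) ^ 2 * Real.exp ((1 + 192 * (1 + B.bound) * D) * T)) *
          ∫⁻ x in {x : E4 | x 0 ∈ Set.Icc 0 T},
            ENNReal.ofReal (KerrSchild.waveOperator B.inverseMetric W x ^ 2) := hest
      _ ≤ ENNReal.ofReal (18 * (1 + B.bound) ^ 2 * Real.exp ((1 + 192 * (1 + B.bound) * D) * T)) *
          slabSqNorm (Kerr.exterior M a) (fun x ↦
            (Kerr.smoothMetric M a (Kerr.rPlus M a)).toPseudoRiemannianMetric.dalembertian u x) T :=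
          mul_le_mul_right hslab _
      _ = _ := by rw [hBbound]

/-- **(A′) The Cauchy problem and the energy estimate for `□_g` on the Kerr exterior, with a
constant depending on the support — proved from the named fact `KerrSchild.waveCauchyProblem`.**
For `0 < M`, any `a`, a compact subset `S` of the exterior chart and a time `T` there is
`K < ∞` such that every `C^∞` function `u` on the chart vanishing off `S` is matched by a `C^∞`
solution `ψ` of `□_{g_{M,a}} ψ = 0` on the *whole* chart with the Cauchy data of `u` on `{t* = 0}`
and `sliceEnergy (ψ − u) τ ≤ K · slabSqNorm (□u) T` for `0 ≤ τ ≤ T` (`kerr_energyEstimate_core`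
with `ρ = R_S + |T| + 1`, `R_S` a bound for `S`, and `D` a bound for `|∂g⁻¹|` of the background on
the compact `{0 ≤ t ≤ T} ∩ {‖x⃗‖ ≤ ρ}`). The support-uniform version is
`KerrWaveCauchyEnergyEstimate.of_waveCauchyProblem` below. Sbierski, Anal. PDE 8 (2015), proof of
Thm. 2.1 ("(M, g) globally hyperbolic ⟹ well-posed initial value problem" and the energy
estimate). [cite: Sbierski2015, §2 proof of Thm. 2.1 (energy estimate); BarGinouxPfaffle2007 Thm. 3.2.11] -/
theorem kerr_localEnergyEstimate_of_waveCauchyProblem (h : KerrSchild.waveCauchyProblem)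
    [Kerr.Facts] [Kerr.SliceFacts] {M a : ℝ} (hM : 0 < M) (S : Set (Kerr.exterior M a))
    (hS : IsCompact S) (T : ℝ) :
    ∃ K : ℝ≥0∞, K < ⊤ ∧ ∀ u : Kerr.exterior M a → ℝ, ContMDiff 𝓘(ℝ, E4) 𝓘(ℝ, ℝ) ∞ u →
      (∀ x, x ∉ S → u x = 0) →
      ∃ ψ : Kerr.exterior M a → ℝ, ContMDiff 𝓘(ℝ, E4) 𝓘(ℝ, ℝ) ∞ ψ ∧
        (∀ x, (Kerr.smoothMetric M a (Kerr.rPlus M a)).toPseudoRiemannianMetric.dalembertian ψ x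
          = 0) ∧
        (∀ x : Kerr.exterior M a, (x : E4) 0 = 0 →
          ψ x = u x ∧ mfderiv 𝓘(ℝ, E4) 𝓘(ℝ, ℝ) ψ x = mfderiv 𝓘(ℝ, E4) 𝓘(ℝ, ℝ) u x) ∧
        ∀ τ : ℝ, 0 ≤ τ → τ ≤ T →
          sliceEnergy (Kerr.exterior M a) (ψ - u) τ ≤
            K * slabSqNorm (Kerr.exterior M a) (fun x ↦
              (Kerr.smoothMetric M a (Kerr.rPlus M a)).toPseudoRiemannianMetric.dalembertian u x) T := by
  set B := Kerr.surgeryBackground M a (Kerr.rPlus M a) hM.le (rPlus_pos_of_pos hM a) with hB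
  -- a radius for the support
  have hS' : IsCompact (Subtype.val '' S : Set E4) := hS.image continuous_subtype_val
  obtain ⟨R_S, hR_S⟩ := hS'.isBounded.subset_closedBall (0 : E4)
  set ρ : ℝ := |R_S| + |T| + 1 with hρ
  -- a bound for the derivatives of the background on the compact slab-cylinder
  set Kc : Set E4 := {x | x 0 ∈ Set.Icc 0 T ∧ E4.spatialNorm x ≤ ρ} with hKc_def
  have hKc : IsCompact Kc := by
    have hc0 : Continuous fun y : E4 ↦ y 0 := (E4.dx 0).continuous
    refine Metric.isCompact_of_isClosed_isBounded ((isClosed_Icc.preimage hc0).inter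
      (isClosed_le E4.continuous_spatialNorm continuous_const)) ?_
    refine (Metric.isBounded_closedBall (x := (0 : E4)) (r := |T| + |ρ|)).subset fun y hy ↦ ?_
    rw [Metric.mem_closedBall, dist_zero_right]
    have h0 : |y 0| ≤ |T| := by
      rw [abs_le]
      exact ⟨by linarith [hy.1.1, abs_nonneg T], hy.1.2.trans (le_abs_self T)⟩
    have h1 : E4.spatialNorm y ≤ |ρ| := hy.2.trans (le_abs_self ρ)
    linarith [norm_le_abs_add_spatialNorm y]
  have hFc : Continuous fun x ↦ ∑ μ, ∑ α, ∑ β,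
      |fderiv ℝ (fun y ↦ B.inverseMetric y α β) x (E4.basisVector μ)| :=
    continuous_finsetSum _ fun μ _ ↦ continuous_finsetSum _ fun α _ ↦ continuous_finsetSum _
      fun β _ ↦ (((B.contDiff_one_inverseMetric α β).continuous_fderiv one_ne_zero).clm_apply
        continuous_const).abs
  obtain ⟨D₀, hD₀⟩ := hKc.exists_bound_of_continuousOn hFc.continuousOn
  set D : ℝ := max D₀ 0 with hD_def
  have hD0 : 0 ≤ D := le_max_right _ _
  have hD : ∀ x : E4, 0 ≤ x 0 → x 0 ≤ T → E4.spatialNorm x ≤ ρ →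
      ∀ μ α β, |fderiv ℝ (fun y ↦ B.inverseMetric y α β) x (E4.basisVector μ)| ≤ D := by
    intro x h0 hT hx μ α β
    have hxK : x ∈ Kc := ⟨⟨h0, hT⟩, hx⟩
    have hle := hD₀ x hxK
    rw [Real.norm_of_nonneg (Finset.sum_nonneg fun _ _ ↦ Finset.sum_nonneg fun _ _ ↦
      Finset.sum_nonneg fun _ _ ↦ abs_nonneg _)] at hle
    have h1 : |fderiv ℝ (fun y ↦ B.inverseMetric y α β) x (E4.basisVector μ)| ≤
        ∑ μ, ∑ α, ∑ β, |fderiv ℝ (fun y ↦ B.inverseMetric y α β) x (E4.basisVector μ)| := by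
      refine (Finset.single_le_sum (f := fun μ ↦ ∑ α, ∑ β,
        |fderiv ℝ (fun y ↦ B.inverseMetric y α β) x (E4.basisVector μ)|)
        (fun _ _ ↦ Finset.sum_nonneg fun _ _ ↦ Finset.sum_nonneg fun _ _ ↦ abs_nonneg _)
        (Finset.mem_univ μ)).trans' ?_
      refine (Finset.single_le_sum (f := fun α ↦ ∑ β,
        |fderiv ℝ (fun y ↦ B.inverseMetric y α β) x (E4.basisVector μ)|)
        (fun _ _ ↦ Finset.sum_nonneg fun _ _ ↦ abs_nonneg _) (Finset.mem_univ α)).trans' ?_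
      exact Finset.single_le_sum (f := fun β ↦
        |fderiv ℝ (fun y ↦ B.inverseMetric y α β) x (E4.basisVector μ)|)
        (fun _ _ ↦ abs_nonneg _) (Finset.mem_univ β)
    exact (h1.trans hle).trans (le_max_left _ _)
  -- the constant
  refine ⟨ENNReal.ofReal (18 * (1 + 4 * M / Kerr.rPlus M a) ^ 2 *
      Real.exp ((1 + 192 * (1 + 4 * M / Kerr.rPlus M a) * D) * T)), ENNReal.ofReal_lt_top,
    fun u hu hu0 ↦ ?_⟩
  obtain ⟨ψ, hψ, hwave, hdata, hest⟩ := kerr_energyEstimate_core h hM hS hu hu0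
  refine ⟨ψ, hψ, hwave, hdata, fun τ hτ0 hτT ↦ hest T ρ D hD0 (fun z hz ↦ ?_) hD τ hτ0 hτT⟩
  have := hR_S ⟨z, hz, rfl⟩
  rw [Metric.mem_closedBall, dist_zero_right] at this
  linarith [le_abs_self R_S]

/-- **(A) `KerrWaveCauchyEnergyEstimate` from `KerrSchild.waveCauchyProblem`: the Cauchy problem
with the energy estimate for `□_g` on the Kerr exterior, with a constant `K(T)` *independent of the
support of the data*.** The named fact (A) of `TrappingDerivativeLossInputs.lean` (Sbierski,
Anal. PDE 8 (2015), proof of Thm. 2.1: well-posedness on the globally hyperbolic `D(Σ₀)` and the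
energy estimate `∫_{Σ_τ} J^N·n ≤ C(T, N, {Σ_τ})(∫_{Σ_0} J^N·n + ‖□u‖²_{L²(R_{[0,T]})})`,
uniform under the condition of Thm. 2.1) follows from the Cauchy problem on generalised
Kerr–Schild backgrounds: `kerr_energyEstimate_core` with the *global* derivative bound of the
surgered background `Kerr.exists_bound_fderiv_surgeryBackground_inverseMetric`
(`KerrSurgeryBackgroundBounds.lean`), the radius `ρ = R_S + |T| + 1` being chosen after `u` and
`T` without affecting the constant `K(T) = 18 (1 + 4M/r₊)² e^{(1 + 192 (1 + 4M/r₊) D) T}`.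
[cite: Sbierski2015, §2 proof of Thm. 2.1 (energy estimate) with Thm. 7.4; BarGinouxPfaffle2007 Thm. 3.2.11] -/
theorem KerrWaveCauchyEnergyEstimate.of_waveCauchyProblem (h : KerrSchild.waveCauchyProblem) :
    KerrWaveCauchyEnergyEstimate := by
  intro _ _ M a hM ha₀ haM
  obtain ⟨D, hD0, hD⟩ :=
    Kerr.exists_bound_fderiv_surgeryBackground_inverseMetric hM.le a (rPlus_pos_of_pos hM a)
  refine ⟨fun T ↦ ENNReal.ofReal (18 * (1 + 4 * M / Kerr.rPlus M a) ^ 2 *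
      Real.exp ((1 + 192 * (1 + 4 * M / Kerr.rPlus M a) * D) * T)),
    fun T ↦ ENNReal.ofReal_lt_top, fun u hu hsupp ↦ ?_⟩
  obtain ⟨S, hS, hu0⟩ := hsupp
  obtain ⟨ψ, hψ, hwave, hdata, hest⟩ := kerr_energyEstimate_core h hM hS hu hu0
  refine ⟨ψ, hψ, fun x _ ↦ hwave x, hdata, fun T τ hτ0 hτT ↦ ?_⟩
  -- a radius for the support, chosen after `u` and `T`
  have hS' : IsCompact (Subtype.val '' S : Set E4) := hS.image continuous_subtype_val
  obtain ⟨R_S, hR_S⟩ := hS'.isBounded.subset_closedBall (0 : E4)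
  refine hest T (|R_S| + |T| + 1) D hD0 (fun z hz ↦ ?_) (fun x _ _ _ μ α β ↦ hD x μ α β) τ hτ0 hτT
  have := hR_S ⟨z, hz, rfl⟩
  rw [Metric.mem_closedBall, dist_zero_right] at this
  linarith [le_abs_self R_S]

/-! ### The localised solutions and the barrier from `waveCauchyProblem` and the beams -/

/-- **Sbierski's localised solutions from the two canonical named facts, through the support-local
energy estimate (A′)**: the Cauchy problem on generalised Kerr–Schild backgrounds
(`KerrSchild.waveCauchyProblem`, Bär–Ginoux–Pfäffle Thm. 3.2.11 with Choquet-Bruhat–Cotsakis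
Thm. 2.1) and the literal Gaussian-beam fact along the trapped geodesics of Kerr
(`SbierskiKerrTrappedGeodesicBeams`, Sbierski §3–§4, §7A) imply `SbierskiKerrLocalisedSolutions`.
The proof of Thm. 2.1 / Thm. 5.1 as in `SbierskiKerrLocalisedSolutions.of_inputs`, with the proved
support-local energy estimate `kerr_localEnergyEstimate_of_waveCauchyProblem` in place of the named
fact (A) and the uniform-support beams
`SbierskiKerrTrappedGeodesicBeams.gaussianBeams_uniformSupport`: given `T` take the compact `S` of
the beams first, then the constant `K = K(S, T)`, then `ε` with `K ε ≤ c_B/4`, then the beam.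
[cite: Sbierski2015, Thm. 2.1 (proof) and Thm. 5.1 with §7A] -/
theorem SbierskiKerrLocalisedSolutions.of_waveCauchyProblem_of_trappedGeodesicBeams
    (h : KerrSchild.waveCauchyProblem) (hB : SbierskiKerrTrappedGeodesicBeams) :
    SbierskiKerrLocalisedSolutions := by
  intro _ _ M a hM ha₀ haM
  obtain ⟨R₀, hR⟩ := hB.gaussianBeams_uniformSupport hM ha₀ haM
  refine ⟨R₀, fun R hRR ↦ ?_⟩
  obtain ⟨cB, C, hcB, hbeamT⟩ := hR R hRR
  refine ⟨cB / 4, C, by positivity, fun T hT ↦ ?_⟩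
  obtain ⟨S, hS, hbeam⟩ := hbeamT T hT
  obtain ⟨K, hKfin, hsolve⟩ := kerr_localEnergyEstimate_of_waveCauchyProblem h hM S hS T
  -- ### choice of `ε` with `K · ε ≤ c_B / 4`
  set k : ℝ := K.toReal with hk
  have hk0 : 0 ≤ k := ENNReal.toReal_nonneg
  set ε : ℝ := cB / (4 * (k + 1)) with hε_def
  have hε : 0 < ε := by positivity
  have hKε : K * ENNReal.ofReal ε ≤ ENNReal.ofReal (cB / 4) := by
    have hKT : K = ENNReal.ofReal k := (ENNReal.ofReal_toReal hKfin.ne).symm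
    rw [hKT, ← ENNReal.ofReal_mul hk0]
    refine ENNReal.ofReal_le_ofReal ?_
    rw [hε_def, mul_div_assoc']
    rw [div_le_div_iff₀ (by positivity) (by positivity)]
    nlinarith
  -- ### the beam and the solution with its data
  obtain ⟨u, hu, hsupp, hdata, hE₀, hbox, hloc⟩ := hbeam ε hε
  obtain ⟨ψ, hψ, hwave, hagree, hest⟩ := hsolve u hu hsupp
  have hinf : (∞ : ℕ∞ω) ≠ 0 := by simp
  refine ⟨ψ, hψ, fun x _ ↦ hwave x, ?_, ?_, ?_⟩
  · intro x hx0 hxR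
    obtain ⟨h1, h2⟩ := hagree x hx0
    obtain ⟨h3, h4⟩ := hdata x hx0 hxR
    exact ⟨h1.trans h3, h2.trans h4⟩
  · rw [sliceEnergy_congr_of_mfderiv_eq hinf hψ hu 0 fun x hx ↦ (hagree x hx).2]
    exact hE₀
  · intro τ hτ₀ hτT
    have hsplit := localSliceEnergy_le_two_mul_add (U := Kerr.exterior M a) hinf hψ hu τ R
    have hdiff : localSliceEnergy (Kerr.exterior M a) (ψ - u) τ R ≤ ENNReal.ofReal (cB / 4) :=
      calc localSliceEnergy (Kerr.exterior M a) (ψ - u) τ R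
          ≤ sliceEnergy (Kerr.exterior M a) (ψ - u) τ := localSliceEnergy_le_sliceEnergy _ _ _ _
        _ ≤ K * slabSqNorm (Kerr.exterior M a) (fun x ↦
              (Kerr.smoothMetric M a (Kerr.rPlus M a)).toPseudoRiemannianMetric.dalembertian u x)
              T := hest τ hτ₀ hτT
        _ ≤ K * ENNReal.ofReal ε := by gcongr
        _ ≤ ENNReal.ofReal (cB / 4) := hKε
    have hmain : ENNReal.ofReal cB ≤
        2 * localSliceEnergy (Kerr.exterior M a) ψ τ R + ENNReal.ofReal (cB / 2) :=
      calc ENNReal.ofReal cB ≤ localSliceEnergy (Kerr.exterior M a) u τ R := hloc τ hτ₀ hτT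
        _ ≤ 2 * localSliceEnergy (Kerr.exterior M a) ψ τ R +
              2 * localSliceEnergy (Kerr.exterior M a) (ψ - u) τ R := hsplit
        _ ≤ 2 * localSliceEnergy (Kerr.exterior M a) ψ τ R + 2 * ENNReal.ofReal (cB / 4) := by
            gcongr
        _ = 2 * localSliceEnergy (Kerr.exterior M a) ψ τ R + ENNReal.ofReal (cB / 2) := by
            rw [← ENNReal.ofReal_ofNat 2, ← ENNReal.ofReal_mul zero_le_two]
            congr 2
            ring
    by_contra hlt
    rw [not_le] at hlt
    have h2lt : 2 * localSliceEnergy (Kerr.exterior M a) ψ τ R < 2 * ENNReal.ofReal (cB / 4) :=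
      ENNReal.mul_lt_mul_right two_ne_zero ENNReal.ofNat_ne_top hlt
    have h3 : 2 * localSliceEnergy (Kerr.exterior M a) ψ τ R + ENNReal.ofReal (cB / 2) <
        2 * ENNReal.ofReal (cB / 4) + ENNReal.ofReal (cB / 2) :=
      ENNReal.add_lt_add_right ENNReal.ofReal_ne_top h2lt
    have h4 : 2 * ENNReal.ofReal (cB / 4) + ENNReal.ofReal (cB / 2) = ENNReal.ofReal cB := by
      rw [← ENNReal.ofReal_ofNat 2, ← ENNReal.ofReal_mul zero_le_two,
        ← ENNReal.ofReal_add (by positivity) (by positivity)]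
      congr 1
      ring
    rw [h4] at h3
    exact absurd (hmain.trans_lt h3) (lt_irrefl _)

/-- **The barrier from the two canonical named facts**: `KerrSchild.waveCauchyProblem` and
`SbierskiKerrTrappedGeodesicBeams` give the data-localised trapping obstruction
`SbierskiTrappingObstruction` (Thm. 5.5 argument, `SbierskiTrappingObstruction.of_localisedSolutions`).
The energy-estimate input of Sbierski's proof of Thm. 2.1 is no longer part of the trust base.
[cite: Sbierski2015, Thm. 7.4 with Thm. 5.5 and Thm. 2.1] -/
theorem SbierskiTrappingObstruction.of_waveCauchyProblem_of_trappedGeodesicBeams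
    (h : KerrSchild.waveCauchyProblem) (hB : SbierskiKerrTrappedGeodesicBeams) :
    SbierskiTrappingObstruction :=
  SbierskiTrappingObstruction.of_localisedSolutions
    (SbierskiKerrLocalisedSolutions.of_waveCauchyProblem_of_trappedGeodesicBeams h hB)

/-- **Sbierski's Kerr trapping theorem (print-literal Thm. 7.4) from the two canonical named
facts**, via the data-localised obstruction and `SbierskiTrappingObstruction.literal`.
[cite: Sbierski2015, Thm. 7.4] -/
theorem SbierskiKerrTrappingLED.of_waveCauchyProblem_of_trappedGeodesicBeams
    (h : KerrSchild.waveCauchyProblem) (hB : SbierskiKerrTrappedGeodesicBeams) :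
    SbierskiKerrTrappingLED :=
  SbierskiTrappingObstruction.literal
    (SbierskiTrappingObstruction.of_waveCauchyProblem_of_trappedGeodesicBeams h hB)

/-- **Sbierski's localised solutions from `waveCauchyProblem` and the coordinate-energy beams (B)**
(no uniform support needed once (A) holds with a support-independent constant):
`SbierskiKerrLocalisedSolutions.of_inputs` with `KerrWaveCauchyEnergyEstimate.of_waveCauchyProblem`.
[cite: Sbierski2015, Thm. 2.1 (proof) and Thm. 5.1] -/
theorem SbierskiKerrLocalisedSolutions.of_waveCauchyProblem_of_gaussianBeams
    (h : KerrSchild.waveCauchyProblem) (hB : SbierskiKerrGaussianBeams) :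
    SbierskiKerrLocalisedSolutions :=
  SbierskiKerrLocalisedSolutions.of_inputs (KerrWaveCauchyEnergyEstimate.of_waveCauchyProblem h) hB

/-- The data-localised barrier from `waveCauchyProblem` and the coordinate-energy beams (B).
[cite: Sbierski2015, Thm. 7.4 with Thm. 5.5 and Thm. 2.1] -/
theorem SbierskiTrappingObstruction.of_waveCauchyProblem_of_gaussianBeams
    (h : KerrSchild.waveCauchyProblem) (hB : SbierskiKerrGaussianBeams) :
    SbierskiTrappingObstruction :=
  SbierskiTrappingObstruction.of_inputs (KerrWaveCauchyEnergyEstimate.of_waveCauchyProblem h) hB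

end Literature.Barriers.FinalStateConjecture

end
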